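import Literature.MathematicalPhysics.QuantumFieldTheory.Balaban1983to89.B1Ineq233LowerZeroField
import Literature.MathematicalPhysics.QuantumFieldTheory.Balaban1983to89.B1Ineq234Concrete
import Literature.MathematicalPhysics.QuantumFieldTheory.Balaban1983to89.B2Prop31ZeroFieldConcrete

/-!
# `Balaban1983to89.B1Ineq233LowerZeroFieldTorus` — T. Bałaban, *(Higgs)₂,₃ quantum fields in a finite volume. I. A lower bound*,
# Commun. Math. Phys. **85** (1982) 603–626 [Balaban1982Higgs1], Proposition 2.3 p. 611: the LOWER HALF of (2.33)
# `γ₀I ≦ aL^{−2}P(A) + Δ^{(k)}(Ω, A)` AT ZERO FIELD ON THE WHOLE TORUS (`A = 0`, `Ω = T_ε`) for the CONCRETE (Higgs)₂,₃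
# operators (`B1Eq230FluctCov.precOpA`), UNCONDITIONALLY, with ONE explicit `γ₀(d, a, L, m²)` for all `1 ≤ k < K`, all
# volumes and all `ε` with `L^kε ≤ 1` — `B1Ineq233LowerZeroField.ineq233_lower_zero_of_delta` (block Poincaré) fed with
# p15's zero-field per-scale inequality (II.3.29)₀ `B2Prop31ZeroFieldConcrete.ineq329_zero_deltaKA` on the trivial regions
# `Λ_k = T^{(k)}`; and, as corollaries, (2.34)/(2.36) at zero field on the whole torus GIVEN ONLY the short-range input of
# [B4] §5 ((5.4), resp. the Cor. 2.3 pairing decay) — `B1Ineq234Concrete` with its `hlow` hypothesis DISCHARGED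

statement-level skeleton of published theorems with citation tags; proofs where landed; nothing here is a claim about the Yang–Mills mass gap

PDFs held: `paper:balaban1982-cmp85-higgs23-i` (journal page = PDF page + 602), pp. 610–612 [PDF 8–10]; `paper:balaban1982-cmp86-higgs23-ii`
(journal page = PDF page + 554), pp. 589–590 [PDF 35–36]; `paper:balaban1983-cmp89-regularity-decay` (journal page = PDF page +
570), pp. 593–594 [PDF 23–24] — read on the ×2 renders under `run/shared/lean/pub/pub-balaban/b2b-balaban-ref1/pages/`.

CITATION HEADER (lean-in-tree rule).  Cell `lit-balaban` (HOME `run/shared/lean/pub/lit-balaban/`), seat **r14** gen 7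
(reader/typer of B1/B2, fold owner of SKELETON row **B1.Prop2.3**; unit `lit-balaban-r14-g7`).  WHAT IS REPRODUCED: row
B1.Prop2.3, member (2.33) LOWER HALF (and the (2.34)/(2.36) corollaries), kind «model instance at zero field on the concrete
carrier»: the decls of record `B1.Prop23Literal` / `B1.Prop23Intended` (pv07) are UNTOUCHED; this file only COMPOSES, by name,
`B1Ineq233LowerZeroField` (r14 g7, the block-Poincaré reduction of (2.33)ₗ at `A = 0` to the (3.29)₀ shape),
`B2Prop31ZeroFieldConcrete` (p15 g4, (3.29)₀ for the concrete `Δ^{(k)}(B^k(Λ_k), 0)` on p15's `Regions`) and `B1Ineq234Concrete`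
(r14 g7, (2.34)/(2.36) from (2.33)ₗ + the §5 short-range input).  Nothing is redefined; no definition at all in this file.

WHAT IS PRINTED.  B1 p. 611 [PDF 9]: *"Proposition 2.3. If a configuration A is regular on Ω …, then there exist positive
constants δ₀, c₀, γ₀, γ₁, dependent on d and a, and independent of A, k, Ω and Λ, such that γ₀I ≦ aL^{−2}P(A) + Δ^{(k)}(Ω, A)
≦ γ₁I, (2.33) |C^{(k)}_Λ(Ω, A; y, y′)| ≦ c₀ exp(−δ₀|y − y′|), y, y′ ∈ Λ. (2.34)"*; p. 612: *"|δC^{(k)}_Λ(Ω, A; y, y′)| ≦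
c₀ exp(−δ₀(dist(y, Λᶜ) + |y − y′| + dist(y′, Λᶜ))) (2.36)"*; p. 610: the operators are considered *"on the unit lattice"*
after the rescaling (2.22), `L^kη = 1`.  II p. 590 (3.29) at `Ã = 0` (p. 589: *"If Ã^ε = 0, then the inequality holds …
without any restrictions"*): `⟨φ′_k, Δ^{(k)}(B^k(Λ_k), 0)φ′_k⟩ ≧ γ₀(Σ_{⟨x,x′⟩⊂Λ_k}(L^kε)^{d−2}|φ′_k(x′) − φ′_k(x)|² + Σ_{x∈Λ_k}(L^kε)^d m²|φ′_k(x)|²)`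
*"with a constant γ₀ independent of k, Λ_k"*.  [Balaban1983RegularityDecay] p. 593 (5.1)/(5.6) and p. 594 (5.4), (5.7), (5.8):
the §5 route from the form lower bound + the short-range bound to (2.34)/(2.36).

WHAT THIS FILE PROVES (kernel-checked, zero `sorry`, standard axioms; theorems only):
* §1 the trivial regions `Λ_k = T^{(k)}` of p15's `Regions`: `pieceF_eq_univ` (`B^k(T^{(k)}) = T_ε`), `extL_comp_val`
  (zero extension from all of `T^{(k)}` is the identity), `bondK_comp_val`/`massK_comp_val` (p15's (3.26) sums are the
  (1.5)-forms `⟨∂ψ, ∂ψ⟩` and `m²‖ψ‖²`).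
* §2 **`delta_lower_zeroField`**: `γ₀·(⟨∂ψ,∂ψ⟩ + m²‖ψ‖²) ≤ ⟨ψ, Δ^{(k),L^kε}(T_ε, 0)ψ⟩` for EVERY field `ψ` on `T^{(k)}`,
  `1 ≤ k ≤ K`, `L^kε ≤ 1`, `m² > 0`, `a > 0`, `L > 1`, with p15's `γ₀ = gamma0 P a m² = min(a(1 − L⁻²)/(8d + 2m²), 1/4)`
  ((3.29)₀ on the whole torus; `delta_lower_zeroField_bond`: the bond part); level `0`: `siteInner_deltaKA_levelZero`
  (`⟨ψ, Δ^{(0),ε}(T_ε,0)ψ⟩ = ⟨∂ψ,∂ψ⟩ + m²‖ψ‖²`, (2.17) at `A = 0`).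
* §3 **`ineq233_lower_zeroField`** (`1 ≤ k < K`, `L^kε ≤ 1`), `ineq233_lower_zeroField_levelZero` (`k = 0`, every `ε`,
  `a, m² ≥ 0`, any `γ₀ ≤ 1`) and **`ineq233_lower_zeroField_all`** (`0 ≤ k < K`, `L^kε ≤ 1`):
  `(min{a, 8γ₀}/L²)(L^kε)^{−2}‖ψ‖² ≤ ⟨ψ, (a(L^{k+1}ε)^{−2}P(0) + Δ^{(k),L^kε}(T_ε,0))ψ⟩` for every `ψ`;
  `ineq233_lower_zeroField_uniform` (the scale-free consequence `(min{a, 8γ₀}/L²)‖ψ‖² ≤ ⟨ψ, precOpA ψ⟩`);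
  **`ineq233_lower_zeroField_unitAt`**: on the unit lattice `P.unitAt k` (p. 610, `L^kη = 1`) the printed
  `γ₀I ≤ aL^{−2}P(0) + Δ^{(k)}(T, 0)` with `γ₀ ↦ min{a, 8γ₀}/L²`, `0 ≤ k < K`, NO smallness hypothesis — companion of
  `B1Ineq233Upper.ineq233_upper_unitAt`.
* §4 (2.34)/(2.36) AT ZERO FIELD ON THE WHOLE TORUS with `hlow` discharged: `ineq234_zeroField_of_ker` (`0 ≤ k < K`, given
  (5.4) for the kernel of `precOpA`), **`ineq234_zeroField_of_sep`/`ineq236_zeroField_of_sep`** (`1 ≤ k < K`, given the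
  [B4] Cor. 2.3 pairing decay of `G^ε_k(T_ε, 0)`), explicit constants through `B4Sect5Torus.cSt/dSt`.
HONEST SCOPE.  (i) Zero external field and `Ω = T_ε` only (for `Ω ≠ T_ε` the typer's operators act on all fields of
`T^{(k)}`, where a bound uniform over ALL fields is not the printed claim; general regular `A` = [B4] Prop. II.3.1′, not
here).  (ii) `γ₀ ↦ min{a, 8γ₀(p15)}/L²` depends on `d, a, L, m²` (the print: "on d and a"; `L`, `m²` enter through (3.29)'s
`γ₀` and the block Poincaré constant `L²/8`, gap `8` not `π²` — census G-B4-03).  (iii) `L^kε ≤ 1` (`k ≥ 1`) is (3.29)'s standing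
hypothesis `ε ≤ 1` at scale `k`; on the unit lattice it is automatic; at `k = 0` nothing is needed.  (iv) §4 still ASSUMES the short-range input ((5.4) /
Cor. 2.3), which is NOT proved here.  (v) Value = kernel certificate that the printed lower bound holds for the concrete
objects at zero field; NOT summit progress.  Unit `lit-balaban-r14-g7` (literature-prover-lit-balaban-r14-g7-0); HOME/FILED.md
records the proposal.
-/

open scoped BigOperators InnerProductSpace

namespace Literature.MathematicalPhysics.QuantumFieldTheory.Balaban1983to89.B1Ineq233LowerZeroFieldTorus

open HiggsLattice HiggsAveraging HiggsCovariance HiggsCovariancePos B1Eq230FluctCov B1Eq230FluctCovPos HiggsCondCov232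
open HiggsFluctMeasure (coeff221)
open HiggsFluctMeasurePos (siteInner_add_right siteInner_smul_right)
open B2Eq337ScalarIntegration (Regions V)
open B2Eq328ConcretePieces (LSite pieceF inPiece mem_pieceF)
open B2Eq328DeltaK (extL)
open B2Prop31ZeroFieldConcrete (bondK massK gamma0 gamma0_pos ineq329_zero_deltaKA massK_eq_siteInner)
open B1Ineq233LowerZeroField (ineq233_lower_zero_of_delta)
open B1Ineq234Concrete (profile distC ineq234_concrete ineq234_concrete_of_sep ineq236_concrete_of_sep)
open B4Sect5Torus (cSt dSt)

variable {P : HiggsLattice.Params} {N K : ℕ}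

/-! ## §1 The trivial regions `Λ_k = T^{(k)}` -/

section Whole

variable (R : Regions P K) (j : Fin K)

/-- If `Λ_k = T^{(k)}` then `B^k(Λ_k) = T_ε`. [cite: Balaban1982Higgs2, (3.28) p.589] -/
theorem pieceF_eq_univ (hR : R.block j = Finset.univ) : pieceF R j = Finset.univ := by
  ext x
  simp only [Finset.mem_univ, mem_pieceF, inPiece, hR]

/-- If `Λ_k = T^{(k)}` every bond of `T^{(k)}` lies inside `Λ_k`. [cite: Balaban1982Higgs2, (3.26) p.589] -/
theorem inside_of_univ (hR : R.block j = Finset.univ) (c : HiggsLattice.PBond P (j.val + 1)) : Inside (R.block j) c := by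
  rw [hR]
  exact ⟨Finset.mem_univ _, Finset.mem_univ _⟩

/-- If `Λ_k = T^{(k)}` the zero extension `ψ̃` of the restriction of a field `ψ` on `T^{(k)}` is `ψ`.
[cite: Balaban1982Higgs2, (3.24) p.588] -/
theorem extL_comp_val (hR : R.block j = Finset.univ) (ψ : ScalarField P (j.val + 1) N) :
    extL R j (fun y : LSite R j => ψ y.1) = ψ := by
  funext y
  have hy : y ∈ R.block j := hR ▸ Finset.mem_univ y
  unfold extL
  rw [dif_pos hy]

/-- If `Λ_k = T^{(k)}`, p15's bond sum of (3.26) is the (1.5)-form `⟨∂ψ, ∂ψ⟩` over all bonds of `T^{(k)}`.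
[cite: Balaban1982Higgs2, Prop. 3.1 (3.26) p.589] -/
theorem bondK_comp_val (hR : R.block j = Finset.univ) (ψ : ScalarField P (j.val + 1) N) :
    bondK R j (fun y : LSite R j => ψ y.1) = bondInner (sderiv ψ) (sderiv ψ) := by
  rw [bondK, bondInner, extL_comp_val R j hR]
  refine Finset.sum_congr rfl fun c _ => ?_
  rw [if_pos (inside_of_univ R j hR c), real_inner_self_eq_norm_sq]

/-- If `Λ_k = T^{(k)}`, p15's mass sum of (3.26) is `m²‖ψ‖²` in the (1.5)-norm. [cite: Balaban1982Higgs2, Prop. 3.1 (3.26) p.589] -/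
theorem massK_comp_val (hR : R.block j = Finset.univ) (msq : ℝ) (ψ : ScalarField P (j.val + 1) N) :
    massK R msq j (fun y : LSite R j => ψ y.1) = msq * siteInner ψ ψ := by
  rw [massK_eq_siteInner, extL_comp_val R j hR]

end Whole

/-! ## §2 (3.29)₀ on the whole torus -/

section Delta

variable (C : ChargeData N) {a msq : ℝ}

/-- **(3.29) at zero field on the whole torus, concrete carrier**: for `m² > 0`, `a > 0`, `L > 1`, `1 ≤ k ≤ K` (`k = j + 1`),
`L^kε ≤ 1` and EVERY field `ψ : T^{(k)} → ℝ^N`,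
`γ₀·(⟨∂ψ, ∂ψ⟩ + m²⟨ψ, ψ⟩) ≤ ⟨ψ, Δ^{(k),L^kε}(T_ε, 0)ψ⟩`, `γ₀ = min(a(1 − L⁻²)/(8d + 2m²), 1/4)` — p15's
`ineq329_zero_deltaKA` on the trivial regions `Λ_k = T^{(k)}`. [cite: Balaban1982Higgs2, (3.29) p.590] -/
theorem delta_lower_zeroField (ha : 0 < a) (hL : 1 < P.L) (hmsq : 0 < msq) {j : ℕ} (hjK : j + 1 ≤ P.K)
    (hs : P.mesh (j + 1) ≤ 1) (ψ : ScalarField P (j + 1) N) :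
    gamma0 P a msq * (bondInner (sderiv ψ) (sderiv ψ) + msq * siteInner ψ ψ)
      ≤ siteInner ψ (deltaKA C Finset.univ (0 : HiggsLattice.VecField P 0) msq a (j + 1) ψ) := by
  set R : Regions P (j + 1) := ⟨∅, fun _ => Finset.univ⟩ with hRdef
  have hR : R.block (Fin.last j) = Finset.univ := rfl
  set ψ' : LSite R (Fin.last j) → V N := fun y => ψ y.1 with hψ'
  have h := ineq329_zero_deltaKA R C ha hL hmsq hjK (Fin.last j) hs ψ'
  have e1 : bondK R (Fin.last j) ψ' = bondInner (sderiv ψ) (sderiv ψ) := bondK_comp_val R _ hR ψ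
  have e2 : massK R msq (Fin.last j) ψ' = msq * siteInner ψ ψ := massK_comp_val R _ hR msq ψ
  have e3 : extL R (Fin.last j) ψ' = ψ := extL_comp_val R _ hR ψ
  have e4 : pieceF R (Fin.last j) = Finset.univ := pieceF_eq_univ R _ hR
  rw [e1, e2, e3, e4] at h
  exact h

/-- The bond part: `γ₀⟨∂ψ, ∂ψ⟩ ≤ ⟨ψ, Δ^{(k),L^kε}(T_ε, 0)ψ⟩` — the `hΔ` input of
`B1Ineq233LowerZeroField.ineq233_lower_zero_of_delta`. [cite: Balaban1982Higgs2, (3.29) p.590] -/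
theorem delta_lower_zeroField_bond (ha : 0 < a) (hL : 1 < P.L) (hmsq : 0 < msq) {j : ℕ} (hjK : j + 1 ≤ P.K)
    (hs : P.mesh (j + 1) ≤ 1) (ψ : ScalarField P (j + 1) N) :
    gamma0 P a msq * bondInner (sderiv ψ) (sderiv ψ)
      ≤ siteInner ψ (deltaKA C Finset.univ (0 : HiggsLattice.VecField P 0) msq a (j + 1) ψ) := by
  have h := delta_lower_zeroField C ha hL hmsq hjK hs ψ
  have hm : 0 ≤ gamma0 P a msq * (msq * siteInner ψ ψ) :=
    mul_nonneg (gamma0_pos ha hL hmsq.le).le (mul_nonneg hmsq.le (siteInner_self_nonneg ψ))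
  rw [mul_add] at h
  linarith

/-- `0 ≤ ⟨f, f⟩` for bond functions in the (1.5)-product. [cite: Balaban1982Higgs1, (1.5) p.604] -/
theorem bondInner_self_nonneg {k : ℕ} (f : HiggsLattice.PBond P k → V N) : 0 ≤ bondInner f f := by
  rw [bondInner]
  exact Finset.sum_nonneg fun b _ => mul_nonneg (pow_nonneg (P.mesh_pos k).le _) real_inner_self_nonneg

/-- **Level `0`**: `Δ^{(0),ε}(T_ε, 0) = −Δ^ε + m²` ((2.17) with `A = 0`, `Ω = T_ε`), so
`⟨ψ, Δ^{(0),ε}(T_ε, 0)ψ⟩ = ⟨∂ψ, ∂ψ⟩ + m²⟨ψ, ψ⟩` — the (3.29)₀ shape with `γ₀ = 1`, every `ε`, every `m²`.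
[cite: Balaban1982Higgs1, (2.17) p.610] -/
theorem siteInner_deltaKA_levelZero (msq a : ℝ) (ψ : ScalarField P 0 N) :
    siteInner ψ (deltaKA C Finset.univ (0 : HiggsLattice.VecField P 0) msq a 0 ψ)
      = bondInner (sderiv ψ) (sderiv ψ) + msq * siteInner ψ ψ := by
  have h0 : covDeriv C (0 : HiggsLattice.VecField P 0) ψ = sderiv ψ := funext (covDeriv_zero C ψ)
  simp only [deltaKA_zero, delta0, LinearMap.add_apply, LinearMap.smul_apply, LinearMap.id_apply,
    siteInner_add_right, siteInner_smul_right]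
  rw [siteInner_covLaplacianN_univ, h0]

end Delta

/-! ## §3 (2.33), lower half, at zero field on the whole torus -/

section Lower

variable (C : ChargeData N) {a msq : ℝ}

/-- The discharged `hlow` constant is positive. [cite: Balaban1982Higgs1, Prop. 2.3 (2.33) p.611] -/
theorem lowConst_pos (ha : 0 < a) (hL : 1 < P.L) (hmsq : 0 ≤ msq) : 0 < min a (8 * gamma0 P a msq) / (P.L : ℝ) ^ 2 := by
  have hL0 : (0 : ℝ) < (P.L : ℝ) := by exact_mod_cast (lt_trans Nat.zero_lt_one hL)
  exact div_pos (lt_min ha (by linarith [gamma0_pos ha hL hmsq])) (pow_pos hL0 2)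

/-- **(2.33) LOWER HALF AT ZERO FIELD ON THE WHOLE TORUS, `1 ≤ k < K`, concrete carrier, unconditional**: for `m² > 0`,
`a > 0`, `L > 1`, `k = j + 1 < K`, `L^kε ≤ 1` and EVERY `ψ : T^{(k)} → ℝ^N`,
`(min{a, 8γ₀}/L²)(L^kε)^{−2}‖ψ‖² ≤ ⟨ψ, (a(L^{k+1}ε)^{−2}P(0) + Δ^{(k),L^kε}(T_ε, 0))ψ⟩`, `γ₀ = gamma0 P a m²`.
[cite: Balaban1982Higgs1, Prop. 2.3 (2.33) p.611] -/
theorem ineq233_lower_zeroField (ha : 0 < a) (hL : 1 < P.L) (hmsq : 0 < msq) {j : ℕ} (hjK : j + 1 < P.K)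
    (hs : P.mesh (j + 1) ≤ 1) (ψ : ScalarField P (j + 1) N) :
    min a (8 * gamma0 P a msq) / (P.L : ℝ) ^ 2 * ((P.mesh (j + 1))⁻¹ ^ 2) * siteInner ψ ψ
      ≤ siteInner ψ (precOpA C Finset.univ (0 : HiggsLattice.VecField P 0) msq a (j + 1) ψ) :=
  ineq233_lower_zero_of_delta C Finset.univ msq a hjK ha.le (gamma0_pos ha hL hmsq.le).le
    (fun ψ => delta_lower_zeroField_bond C ha hL hmsq hjK.le hs ψ) ψ

/-- **(2.33) LOWER HALF AT LEVEL `0`, zero field, whole torus**: for `a ≥ 0`, `m² ≥ 0`, `0 < K`, every `0 ≤ γ₀ ≤ 1`, every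
`ε` and EVERY `ψ : T_ε → ℝ^N`, `(min{a, 8γ₀}/L²)ε^{−2}‖ψ‖² ≤ ⟨ψ, (a(Lε)^{−2}P(0) + (−Δ^ε + m²))ψ⟩` — the block Poincaré
reduction fed with the level-`0` identity `siteInner_deltaKA_levelZero` (no smallness hypothesis at all).
[cite: Balaban1982Higgs1, Prop. 2.3 (2.33) p.611] -/
theorem ineq233_lower_zeroField_levelZero (ha : 0 ≤ a) (hmsq : 0 ≤ msq) (hK : 0 < P.K) {γ₀ : ℝ} (hγ0 : 0 ≤ γ₀)
    (hγ1 : γ₀ ≤ 1) (ψ : ScalarField P 0 N) :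
    min a (8 * γ₀) / (P.L : ℝ) ^ 2 * ((P.mesh 0)⁻¹ ^ 2) * siteInner ψ ψ
      ≤ siteInner ψ (precOpA C Finset.univ (0 : HiggsLattice.VecField P 0) msq a 0 ψ) := by
  have hΔ : ∀ ψ : ScalarField P 0 N, γ₀ * bondInner (sderiv ψ) (sderiv ψ)
      ≤ siteInner ψ (deltaKA C Finset.univ (0 : HiggsLattice.VecField P 0) msq a 0 ψ) := by
    intro ψ
    rw [siteInner_deltaKA_levelZero]
    have hb : 0 ≤ bondInner (sderiv ψ) (sderiv ψ) := bondInner_self_nonneg _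
    nlinarith [mul_nonneg hmsq (siteInner_self_nonneg ψ), mul_le_mul_of_nonneg_right hγ1 hb]
  exact ineq233_lower_zero_of_delta C Finset.univ msq a hK ha hγ0 hΔ ψ

/-- `γ₀ ≤ 1` (indeed `≤ 1/4`). [cite: Balaban1982Higgs2, Prop. 3.1 p.589] -/
theorem gamma0_le_one (P : HiggsLattice.Params) (a msq : ℝ) : gamma0 P a msq ≤ 1 := by
  rw [gamma0]
  exact (min_le_right _ _).trans (by norm_num)

/-- **(2.33) LOWER HALF AT ZERO FIELD ON THE WHOLE TORUS, ALL LEVELS `0 ≤ k < K`, ONE CONSTANT**: for `m² > 0`, `a > 0`,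
`L > 1`, `k < K`, `L^kε ≤ 1` and EVERY `ψ : T^{(k)} → ℝ^N`,
`(min{a, 8γ₀}/L²)(L^kε)^{−2}‖ψ‖² ≤ ⟨ψ, (a(L^{k+1}ε)^{−2}P(0) + Δ^{(k),L^kε}(T_ε, 0))ψ⟩`, `γ₀ = gamma0 P a m²` — uniform in
`k`, the volume and `ε`. [cite: Balaban1982Higgs1, Prop. 2.3 (2.33) p.611] -/
theorem ineq233_lower_zeroField_all (ha : 0 < a) (hL : 1 < P.L) (hmsq : 0 < msq) {k : ℕ} (hk : k < P.K)
    (hs : P.mesh k ≤ 1) (ψ : ScalarField P k N) :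
    min a (8 * gamma0 P a msq) / (P.L : ℝ) ^ 2 * ((P.mesh k)⁻¹ ^ 2) * siteInner ψ ψ
      ≤ siteInner ψ (precOpA C Finset.univ (0 : HiggsLattice.VecField P 0) msq a k ψ) := by
  cases k with
  | zero =>
    exact ineq233_lower_zeroField_levelZero C ha.le hmsq.le hk (gamma0_pos ha hL hmsq.le).le (gamma0_le_one P a msq) ψ
  | succ j => exact ineq233_lower_zeroField C ha hL hmsq hk hs ψ

/-- The scale-free consequence for `L^kε ≤ 1`: `(min{a, 8γ₀}/L²)‖ψ‖² ≤ ⟨ψ, (a(L^{k+1}ε)^{−2}P(0) + Δ^{(k)}(T_ε,0))ψ⟩` —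
ONE constant for all `0 ≤ k < K`, volumes and `ε` (the `hlow` input of `B1Ineq234Concrete`). [cite: Balaban1982Higgs1, Prop. 2.3 (2.33) p.611] -/
theorem ineq233_lower_zeroField_uniform (ha : 0 < a) (hL : 1 < P.L) (hmsq : 0 < msq) {k : ℕ} (hk : k < P.K)
    (hs : P.mesh k ≤ 1) (ψ : ScalarField P k N) :
    min a (8 * gamma0 P a msq) / (P.L : ℝ) ^ 2 * siteInner ψ ψ
      ≤ siteInner ψ (precOpA C Finset.univ (0 : HiggsLattice.VecField P 0) msq a k ψ) := by
  have h := ineq233_lower_zeroField_all C ha hL hmsq hk hs ψ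
  have hc : 0 ≤ min a (8 * gamma0 P a msq) / (P.L : ℝ) ^ 2 := (lowConst_pos ha hL hmsq.le).le
  have hm : (1 : ℝ) ≤ (P.mesh k)⁻¹ ^ 2 := by
    have h1 : (1 : ℝ) ≤ (P.mesh k)⁻¹ := one_le_inv_iff₀.mpr ⟨P.mesh_pos _, hs⟩
    nlinarith
  have hψ : 0 ≤ siteInner ψ ψ := siteInner_self_nonneg ψ
  calc min a (8 * gamma0 P a msq) / (P.L : ℝ) ^ 2 * siteInner ψ ψ
      = min a (8 * gamma0 P a msq) / (P.L : ℝ) ^ 2 * 1 * siteInner ψ ψ := by rw [mul_one]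
    _ ≤ min a (8 * gamma0 P a msq) / (P.L : ℝ) ^ 2 * ((P.mesh k)⁻¹ ^ 2) * siteInner ψ ψ :=
        mul_le_mul_of_nonneg_right (mul_le_mul_of_nonneg_left hm hc) hψ
    _ ≤ _ := h

/-- `γ₀` does not see `ε`: p15's constant over the rescaled parameters is the same number. [cite: Balaban1982Higgs2, Prop. 3.1 p.589] -/
theorem gamma0_unitAt (P : HiggsLattice.Params) (k : ℕ) (a msq : ℝ) : gamma0 (P.unitAt k) a msq = gamma0 P a msq := rfl

/-- **(2.33) LOWER HALF on the UNIT LATTICE** (p. 610: after the rescaling (2.22) the operators are considered on the unit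
lattice, `L^kη = 1`): over the rescaled parameters `P.unitAt k`, for `m² > 0`, `a > 0`, `L > 1`, `0 ≤ k < K`, EVERY `ψ`,
`(min{a, 8γ₀}/L²)‖ψ‖² ≤ ⟨ψ, (aL^{−2}P(0) + Δ^{(k)}(T, 0))ψ⟩` — no smallness hypothesis; companion of
`B1Ineq233Upper.ineq233_upper_unitAt`. [cite: Balaban1982Higgs1, Prop. 2.3 (2.33) p.611] -/
theorem ineq233_lower_zeroField_unitAt (ha : 0 < a) (hL : 1 < P.L) (hmsq : 0 < msq) {k : ℕ} (hkK : k < P.K)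
    (C : ChargeData N) (ψ : ScalarField (P.unitAt k) k N) :
    min a (8 * gamma0 P a msq) / (P.L : ℝ) ^ 2 * siteInner ψ ψ
      ≤ siteInner ψ (precOpA C Finset.univ (0 : HiggsLattice.VecField (P.unitAt k) 0) msq a k ψ) := by
  have h := ineq233_lower_zeroField_all (P := P.unitAt k) C ha hL hmsq hkK (mesh_unitAt_self P k).le ψ
  rw [mesh_unitAt_self, inv_one, one_pow, mul_one] at h
  exact h

end Lower

/-! ## §4 (2.34)/(2.36) at zero field on the whole torus, `hlow` discharged -/

section Decay

variable (C : ChargeData N) {a msq : ℝ}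

/-- **(2.34) AT ZERO FIELD ON THE WHOLE TORUS given (5.4)**: for `m² > 0`, `a > 0`, `L > 1`, `0 ≤ k < K`, `L^kε ≤ 1`, IF the
coordinate kernel of `aL^{−2}(L^kε)^{−2}P(0) + Δ^{(k)}(T_ε, 0)` satisfies (5.4) `|·(p,q)| ≤ c₀e^{−δ₀|x_p − x_q|}`, THEN
`|C^{(k)}_Λ(T_ε, 0; p, q)| ≤ c₁e^{−δ₁|x_p − x_q|}` on `Λ`, every `Λ ⊂ T^{(k)}`, with `(c₁, δ₁) = (cSt, dSt)(N·K_d; γ, c₀, δ₀)`,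
`γ = min{a, 8γ₀}/L²` — `B1Ineq234Concrete.ineq234_concrete` with `hlow` DISCHARGED. [cite: Balaban1982Higgs1, Prop. 2.3 (2.34) p.611] -/
theorem ineq234_zeroField_of_ker (ha : 0 < a) (hL : 1 < P.L) (hmsq : 0 < msq) {k : ℕ} (hk : k < P.K)
    (hs : P.mesh k ≤ 1) {c₀ δ₀ : ℝ} (hc : 0 < c₀) (hδ : 0 < δ₀)
    (hker : ∀ p q : HiggsLattice.Site P k × Ix N,
      |mat (precOpA C Finset.univ (0 : HiggsLattice.VecField P 0) msq a k) p q|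
        ≤ c₀ * Real.exp (-(δ₀ * (HiggsLattice.Site.tdist p.1 q.1 : ℝ))))
    (Λ : Finset (HiggsLattice.Site P k)) {p q : HiggsLattice.Site P k × Ix N} (hp : p.1 ∈ Λ) (hq : q.1 ∈ Λ) :
    |mat (condCov232 C Finset.univ (0 : HiggsLattice.VecField P 0) msq a k Λ) p q| ≤
      cSt (profile P N) (min a (8 * gamma0 P a msq) / (P.L : ℝ) ^ 2) c₀ δ₀ *
        Real.exp (-(dSt (profile P N) (min a (8 * gamma0 P a msq) / (P.L : ℝ) ^ 2) c₀ δ₀ *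
          (HiggsLattice.Site.tdist p.1 q.1 : ℝ))) :=
  ineq234_concrete C Finset.univ 0 msq a (lowConst_pos ha hL hmsq.le) hc hδ
    (fun f => ineq233_lower_zeroField_uniform C ha hL hmsq hk hs f) hker Λ hp hq

/-- **(2.34) AT ZERO FIELD ON THE WHOLE TORUS given the [B4] Cor. 2.3 pairing decay of `G^ε_k(T_ε, 0)`**: for `m² > 0`,
`a > 0`, `L > 1`, `1 ≤ k < K`, `L^kε ≤ 1`, IF `|⟨g, G^ε_k(T_ε,0)g′⟩| ≤ c₀e^{−δ₀R/L^k}‖g‖‖g′‖` whenever the supports of `g`, `g′`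
are `≥ R` apart in `T_ε`, THEN (2.34) for `C^{(k)}_Λ(T_ε, 0)` on every `Λ ⊂ T^{(k)}` with the explicit constants of
`B1Ineq234Concrete.ineq234_concrete_of_sep` at `γ = min{a, 8γ₀}/L²` — `hlow` DISCHARGED. [cite: Balaban1982Higgs1, Prop. 2.3 (2.34) p.611] -/
theorem ineq234_zeroField_of_sep (ha : 0 < a) (hL : 1 < P.L) (hmsq : 0 < msq) {j : ℕ} (hjK : j + 1 < P.K)
    (hs : P.mesh (j + 1) ≤ 1) {c₀ δ₀ : ℝ} (hc : 0 ≤ c₀) (hδ : 0 < δ₀)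
    (hSep : ∀ (R : ℝ) (g g' : ScalarField P 0 N),
      (∀ x x', g x ≠ 0 → g' x' ≠ 0 → R ≤ (HiggsLattice.Site.tdist x x' : ℝ)) →
        |siteInner g (propagatorK C Finset.univ (0 : HiggsLattice.VecField P 0) msq a (j + 1) g')| ≤
          c₀ * Real.exp (-(δ₀ * (R / (P.L : ℝ) ^ (j + 1)))) *
            Real.sqrt (siteInner g g) * Real.sqrt (siteInner g' g'))
    (Λ : Finset (HiggsLattice.Site P (j + 1))) {p q : HiggsLattice.Site P (j + 1) × Ix N} (hp : p.1 ∈ Λ) (hq : q.1 ∈ Λ) :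
    |mat (condCov232 C Finset.univ (0 : HiggsLattice.VecField P 0) msq a (j + 1) Λ) p q| ≤
      cSt (profile P N) (min a (8 * gamma0 P a msq) / (P.L : ℝ) ^ 2)
          (a * ((P.mesh (j + 1 + 1))⁻¹ ^ 2) * Real.exp (δ₀ * ((P.L : ℝ) - 1)) +
            (|coeff221 P a (j + 1)| + coeff221 P a (j + 1) ^ 2 * (c₀ * Real.exp δ₀))) δ₀ *
        Real.exp (-(dSt (profile P N) (min a (8 * gamma0 P a msq) / (P.L : ℝ) ^ 2)
          (a * ((P.mesh (j + 1 + 1))⁻¹ ^ 2) * Real.exp (δ₀ * ((P.L : ℝ) - 1)) +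
            (|coeff221 P a (j + 1)| + coeff221 P a (j + 1) ^ 2 * (c₀ * Real.exp δ₀))) δ₀ *
          (HiggsLattice.Site.tdist p.1 q.1 : ℝ))) :=
  ineq234_concrete_of_sep C Finset.univ 0 msq a hjK ha (lowConst_pos ha hL hmsq.le) hc hδ
    (fun f => ineq233_lower_zeroField_uniform C ha hL hmsq hjK hs f) hSep Λ hp hq

/-- **(2.36) AT ZERO FIELD ON THE WHOLE TORUS given the [B4] Cor. 2.3 pairing decay of `G^ε_k(T_ε, 0)`**: the same inputs
give `|δC^{(k)}_Λ(T_ε, 0; p, q)| ≤ c₁e^{−δ₁(dist(x_p,Λᶜ) + |x_p − x_q| + dist(x_q,Λᶜ))}` on `Λ`, with the explicit constants of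
`B1Ineq234Concrete.ineq236_concrete_of_sep` at `γ = min{a, 8γ₀}/L²`. [cite: Balaban1982Higgs1, Prop. 2.3 (2.36) p.612] -/
theorem ineq236_zeroField_of_sep (ha : 0 < a) (hL : 1 < P.L) (hmsq : 0 < msq) {j : ℕ} (hjK : j + 1 < P.K)
    (hs : P.mesh (j + 1) ≤ 1) {c₀ δ₀ : ℝ} (hc : 0 ≤ c₀) (hδ : 0 < δ₀)
    (hSep : ∀ (R : ℝ) (g g' : ScalarField P 0 N),
      (∀ x x', g x ≠ 0 → g' x' ≠ 0 → R ≤ (HiggsLattice.Site.tdist x x' : ℝ)) →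
        |siteInner g (propagatorK C Finset.univ (0 : HiggsLattice.VecField P 0) msq a (j + 1) g')| ≤
          c₀ * Real.exp (-(δ₀ * (R / (P.L : ℝ) ^ (j + 1)))) *
            Real.sqrt (siteInner g g) * Real.sqrt (siteInner g' g'))
    (Λ : Finset (HiggsLattice.Site P (j + 1))) {p q : HiggsLattice.Site P (j + 1) × Ix N} (hp : p.1 ∈ Λ) (hq : q.1 ∈ Λ) :
    |mat (deltaCov235 C Finset.univ (0 : HiggsLattice.VecField P 0) msq a (j + 1) Λ) p q| ≤
      cSt (profile P N) (min a (8 * gamma0 P a msq) / (P.L : ℝ) ^ 2)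
          (a * ((P.mesh (j + 1 + 1))⁻¹ ^ 2) * Real.exp (δ₀ * ((P.L : ℝ) - 1)) +
            (|coeff221 P a (j + 1)| + coeff221 P a (j + 1) ^ 2 * (c₀ * Real.exp δ₀))) δ₀ *
        Real.exp (-(dSt (profile P N) (min a (8 * gamma0 P a msq) / (P.L : ℝ) ^ 2)
          (a * ((P.mesh (j + 1 + 1))⁻¹ ^ 2) * Real.exp (δ₀ * ((P.L : ℝ) - 1)) +
            (|coeff221 P a (j + 1)| + coeff221 P a (j + 1) ^ 2 * (c₀ * Real.exp δ₀))) δ₀ *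
          ((HiggsLattice.Site.tdist p.1 q.1 : ℝ) + distC Λ p.1 + distC Λ q.1))) :=
  ineq236_concrete_of_sep C Finset.univ 0 msq a hjK ha (lowConst_pos ha hL hmsq.le) hc hδ
    (fun f => ineq233_lower_zeroField_uniform C ha hL hmsq hjK hs f) hSep Λ hp hq

end Decay

end Literature.MathematicalPhysics.QuantumFieldTheory.Balaban1983to89.B1Ineq233LowerZeroFieldTorus
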